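import Summits.BirchSwinnertonDyer.BirchSwinnertonDyer.Theorems.AdditiveBranchIMCMultLowerFieldSupplyMLocal
import Summits.BirchSwinnertonDyer.BirchSwinnertonDyer.Theorems.AdditiveBranchIMCGordTwoRankZeroOffCaseOneFieldSupplyR0
import Literature.NumberTheory.EllipticCurves.Delbourgo1998.RankZeroLeadingTerm
import Literature.NumberTheory.EllipticCurves.Wuthrich2014.SurjectiveDivisibilityCyclotomicPrimeHalf
import Literature.NumberTheory.EllipticCurves.Skinner2016.RankZeroPPart
import Literature.NumberTheory.EllipticCurves.NonvanishingTwistsPrescribedRamificationSplit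
import Literature.NumberTheory.EllipticCurves.NonvanishingTwistsPrescribedRamificationSimpleZero
import Literature.NumberTheory.EllipticCurves.NonvanishingTwistsHoffsteinLuo
import Literature.NumberTheory.EllipticCurves.NonvanishingTwistsPrescribedSplittingOfHoffsteinLuoProofs
import Literature.NumberTheory.EllipticCurves.ModularParametrizationBCDTProofs
import Literature.NumberTheory.EllipticCurves.BSDQuadraticDescent
import Literature.NumberTheory.EllipticCurves.BSDRootNumber
import Literature.NumberTheory.EllipticCurves.GrossZagierRationalPoint
import Literature.NumberTheory.EllipticCurves.LeadingTerm
import Literature.NumberTheory.EllipticCurves.Tamagawa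
import Literature.NumberTheory.EllipticCurves.Hsieh2014.AnticyclotomicPAdicLFunctionRamifiedSteinberg
import Literature.NumberTheory.EllipticCurves.LiuZhangZhang2018.PAdicWaldspurgerEllipticCurveAdditiveRamifiedSteinberg
import Literature.NumberTheory.EllipticCurves.CaiShuTian2014.ExplicitGrossZagier
import Literature.NumberTheory.EllipticCurves.CaiShuTian2014.ExplicitGrossZagierRingClass
import Literature.NumberTheory.EllipticCurves.Voight2007.RingClassGenusField
import Literature.NumberTheory.EllipticCurves.ManinConstantSemistablePrimewise
import Literature.NumberTheory.EllipticCurves.Gross2004.RationalCharacterLSeries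
import HarnessLib

/-!
# Registered stub `stub_fieldSupplyM` of line `tame_roads_mult` (v4) — PROVED, BY NAME AND SIGNATURE
# (crux `AdditiveBranchIMC.MultLower`, stmt-BirchSwinnertonDyer-19359, route K1 `AdditiveBranchIMC`;
# stub-worker `bsd-line-addord-w2` under LEAD `cruxlead-stmt-BirchSwinnertonDyer-19357`)

HONEST FRAMING. One theorem and two `def … : Prop` (LINE VOCABULARY repeated verbatim from the skeleton
`Cruxes/MultLower/Lines/tame_roads_mult.lean` v4 — `RamifiedKolyvaginFieldM` and the cite-only conjunction
`PrintedFactsM` (19 conjuncts, `HoffsteinLuo1997_exists_twist_L_one_ne_zero` LAST); `WanPrime`, `TameRoadRow`,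
`TameRoadField` are the (G-ord) line's, already declared verbatim in `…GordTwoRankZeroOffCaseOneFieldSupplyR0` —
so that the stub can be stated by name and signature under the Theorems import fence; nothing is asserted by
them). No named fact, no `sorry`; BSD is proved for no curve; the crux item stays OPEN.

THE STUB. On the tame sub-row of the (M) cell in analytic rank `≤ 1`: FIELD 1 (`exists_fieldOne_mult_rankLeOne`,
file `…FieldSupplyR0TameTwist`): F5/F6 at the Wan prime `q` and the auxiliary prime `p` ⟹ the tame-road field
`K` with the complementary `L`-value; the globally minimal `Wd ≅ E^{(d_K)}` has `r_an(E) + r_an(Wd) = 1`, lies on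
the (M) cell, is of class X4(M), `ρ̄` onto, `p ∤ ∏ c(E) → p ∤ ∏ c(Wd)`. FIELD 2 in rank `0`
(`exists_fieldTwo_mult`, files `…MultLowerFieldSupplyMSign`, `…Aux`, `…Twist`, `…Class`, `…Local`): the
MULTIPLICATIVE twist model `C • V^{(p*)} = W` (`AdditivePotMult.PotMult.exists_mult_pStar_twist_model`), the
(M) SIGN LAW at the additive prime fed by that model (Atkin–Lehner/Rohrlich; modularity only), a Dirichlet
prime `ℓ₀` with `(δ₁ℓ₀*/p) = −a_p(V)`, the auxiliary twist `X ≅ E^{(p*δ₁ℓ₀*)}` of root number `−1`,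
Friedberg–Hoffstein with prescribed splitting — DERIVED from conjunct 19 (Hoffstein–Luo 1997) and modularity —
the field `K'' = ℚ(√(p*q*ℓ₀*d))` and the rank-zero partner `A ≅ Wd^{(d_{K''})} ≅ E^{(u)}`, MULTIPLICATIVE and
NON-SPLIT at `p`, with the local analysis at `q`, at `p` and of `∏ c(A)`.

References: [cite: FriedbergHoffstein1995, Thm. B] [cite: HoffsteinLuo1997, Theorem (§1, pp. 435–436)]
[cite: Rohrlich1993Compositio, Prop. 2(ii),(iii)] [cite: AtkinLehner1970, §6]
[cite: SilvermanAEC2009, X.5 Cor. 5.4, VII.6.1, App. C §16]. Axioms: `propext`, `Classical.choice`, `Quot.sound`.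
-/

set_option autoImplicit false
-- D-0017: single-problem summit, so `Summit.BirchSwinnertonDyer.BirchSwinnertonDyer.…` repeats a namespace BY DESIGN.
set_option linter.dupNamespace false

noncomputable section

open scoped Classical

namespace Summit.BirchSwinnertonDyer.BirchSwinnertonDyer.Theorems.ThreeFieldRoadSupply

open NumberField IsDedekindDomain
open WeierstrassCurve Literature.NumberTheory.EllipticCurves
  Literature.NumberTheory.EllipticCurves.ModularForms
  Literature.NumberTheory.EllipticCurves.Rank1Residual
  Literature.NumberTheory.EllipticCurves.Rank1Residual.Typed
open Summit.BirchSwinnertonDyer.Rank1Residual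
open Summit.BirchSwinnertonDyer.Rank1Residual.Additive
open Field Literature.NumberTheory.EllipticCurves.ModularForms

/-! ### Line vocabulary (verbatim from the skeleton; nothing asserted) -/

/-- THE `p`-RAMIFIED KOLYVAGIN FIELD, (M) VERSION: as on the (G-ord) road, but `A` is required to be NON-SPLIT
MULTIPLICATIVE at EVERY prime dividing both `N_{Wd}` and `d_{K″}` — including `p` itself. Verbatim the
skeleton's `RamifiedKolyvaginFieldM`. [predicate; nothing asserted] -/
def RamifiedKolyvaginFieldM (Wd A : WeierstrassCurve ℚ) (p : ℕ) [Fact p.Prime]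
    (K'' : Type) [Field K''] [NumberField K''] : Prop :=
  IsImaginaryQuadratic K'' ∧ (p : ℤ) ∣ NumberField.discr K'' ∧
    (∀ ℓ : ℕ, ℓ.Prime → ℓ ∣ Wd.conductorNorm ℤ → ¬ (ℓ : ℤ) ∣ NumberField.discr K'' →
      SatisfiesHeegnerHypothesis ℓ K'') ∧
    (∀ ℓ : ℕ, (hℓ : ℓ.Prime) → ℓ ∣ Wd.conductorNorm ℤ → (ℓ : ℤ) ∣ NumberField.discr K'' →
      (haveI : Fact ℓ.Prime := ⟨hℓ⟩;
        A.HasMultiplicativeReductionAtPrime ℓ ∧ ¬ A.HasSplitMultiplicativeReductionAtPrime ℓ)) ∧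
    ¬ A.HasSplitMultiplicativeReductionAtPrime p

/-- The printed theorems the (M) road consumes BY NAME — cite-only conjunction, VERBATIM the skeleton's
`PrintedFactsM` (v4, nineteen conjuncts; the last is Hoffstein–Luo 1997). NOTHING IS ASSERTED (each conjunct is
an existing tree `Prop`, cited where it is declared). -/
def PrintedFactsM : Prop :=
  Delbourgo1998.prop4_rankZero_pow_dvd_constantCoeff ∧
    Literature.NumberTheory.EllipticCurves.rank_eq_analyticRank_of_analyticRank_le_one ∧
    WeierstrassCurve.hasEntireLFunction_rat ∧
    Literature.NumberTheory.EllipticCurves.ModularForms.nonempty_modularParametrizationData ∧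
    Wuthrich2014.kato_halfEigenCharIdeal_dvd_cyclotomicPrime_of_surjective ∧
    friedbergHoffstein_exists_twist_ne_zero_ramifiedAt_splitAt ∧
    friedbergHoffstein_exists_twist_simpleZero_ramifiedAt_splitAt ∧
    (∀ W : WeierstrassCurve ℚ,
      Literature.NumberTheory.EllipticCurves.even_analyticRank_iff_rootNumber_eq_one W) ∧
    WeierstrassCurve.bsdRHS_eq_of_isIsogenous ∧
    Literature.NumberTheory.EllipticCurves.GrossZagier1986_thm_I_7_3 ∧
    Skinner2016.thmC_padicValRat_bsd_rank_zero ∧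
    CaiShuTian2014.thm11_trivialChar ∧
    CaiShuTian2014.thm11_ringClassChar ∧
    Voight2007.prop38_sqrt_mem_ringClassField_iff ∧
    mazur_not_dvd_maninConstant_of_odd ∧
    Hsieh2014.thmB_exists_isHsiehLFunction_coeff_norm_eq_one_unrPeriod_ramifiedSteinberg ∧
    LiuZhangZhang2018.thm151_thm153_modularCurve_heegnerVector_additive_ramifiedSteinberg ∧
    Gross2004.rankinLSeries_eq_mul_quadraticTwist ∧
    Literature.NumberTheory.EllipticCurves.HoffsteinLuo1997_exists_twist_L_one_ne_zero

/-! ### The stub -/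

/-- **Registered stub `stub_fieldSupplyM` of line `tame_roads_mult`** (crux `MultLower`,
stmt-BirchSwinnertonDyer-19359), BY NAME AND SIGNATURE — FIELDS 1 AND 2 WITH THEIR CURVES on the (M) cell:
on the tame sub-row in analytic rank `≤ 1`, a tame-road field `K` with a globally minimal twist `Wd` on the
same cell, `r_an(E) + r_an(Wd) = 1` (`ρ̄` onto, class X4(M), `p ∤ ∏ c` transported), and, in rank `0` with
`p ∤ ∏ c(E)`, a `p`-ramified Kolyvagin field `K''` ((M) version, non-split at `p` included) with a free ramified
prime and a globally minimal rank-zero partner `A ≅ Wd^{(d_{K''})}`, MULTIPLICATIVE at `p` (`ρ̄` onto, a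
multiplicative prime `≠ p` with `p ∤ v(Δ)`, `p ∤ ∏ c(A)`). Proof: `exists_fieldOne_mult_rankLeOne` (conjuncts
3, 6, 7, 8) and `exists_fieldTwo_mult` (conjuncts 3, 4, 19: modularity, a parametrisation datum for
`exists_isNewformOf`, Hoffstein–Luo for Friedberg–Hoffstein with prescribed splitting; the multiplicative twist
model by `AdditivePotMult.PotMult.exists_mult_pStar_twist_model`).
[cite: FriedbergHoffstein1995, Thm. B] [cite: HoffsteinLuo1997, Theorem (§1, pp. 435–436)]
[cite: Rohrlich1993Compositio, Prop. 2(ii),(iii)] [cite: SilvermanAEC2009, X.5 Cor. 5.4 and Thm VII.6.1] -/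
theorem stub_fieldSupplyM : PrintedFactsM →
    ∀ (W : WeierstrassCurve ℚ) [W.IsElliptic] [W.IsGloballyMinimal] (p : ℕ) [Fact p.Prime],
      W.analyticRank ≤ 1 → N10.CellM W p → TameRoadRow W p →
        ∃ (K : Type) (_ : Field K) (_ : NumberField K)
          (Wd : WeierstrassCurve ℚ) (_ : Wd.IsElliptic) (_ : Wd.IsGloballyMinimal),
          TameRoadField W p K ∧
          (∃ C : WeierstrassCurve.VariableChange ℚ, C • W.quadraticTwist (NumberField.discr K : ℚ) = Wd) ∧
          W.analyticRank + Wd.analyticRank = 1 ∧ N10.CellM Wd p ∧ AdditivePotMult.ClassX4M Wd p ∧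
          Surj Wd p ∧ (¬ p ∣ W.tamagawaProduct → ¬ p ∣ Wd.tamagawaProduct) ∧
          (W.analyticRank = 0 → ¬ p ∣ W.tamagawaProduct →
            ∃ (K'' : Type) (_ : Field K'') (_ : NumberField K'')
              (A : WeierstrassCurve ℚ) (_ : A.IsElliptic) (_ : A.IsGloballyMinimal),
              RamifiedKolyvaginFieldM Wd A p K'' ∧
              (∃ ℓ : ℕ, ℓ.Prime ∧ (ℓ : ℤ) ∣ NumberField.discr K'' ∧ ℓ ≠ p ∧ ¬ ℓ ∣ Wd.conductorNorm ℤ) ∧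
              (∃ C : WeierstrassCurve.VariableChange ℚ,
                  C • Wd.quadraticTwist (NumberField.discr K'' : ℚ) = A) ∧
              A.analyticRank = 0 ∧ A.HasMultiplicativeReductionAtPrime p ∧ Surj A p ∧
              (∃ ℓ : ℕ, ∃ _ : Fact ℓ.Prime, ℓ ≠ p ∧ A.HasMultiplicativeReductionAtPrime ℓ ∧
                  ¬ p ∣ padicValInt ℓ A.minimalDiscriminantInt) ∧
              ¬ p ∣ A.tamagawaProduct) := by
  intro hF W _ _ p _ hr hcell hrow
  obtain ⟨-, -, hmod, hmodP, -, hF5, hF6, hpar, -, -, -, -, -, -, -, -, -, -, hHL⟩ := hF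
  have hnf : exists_isNewformOf := exists_isNewformOf_of_nonempty_modularParametrizationData hmodP
  have hFH : friedbergHoffstein_exists_heegnerField_splitDivisors_twist_ne_zero :=
    friedbergHoffstein_exists_heegnerField_splitDivisors_twist_ne_zero_of_hoffsteinLuo hnf hHL
  obtain ⟨hp5, hsurj, -, q, hqF, hqp, hq2, hqm, hqns, hqv⟩ := hrow
  have hp2 : p ≠ 2 := by omega
  -- FIELD 1
  obtain ⟨K, iF, iN, Wd, iWd, iWdm, hK, hqd, hsplit, h2, hpK, h2K, ⟨Cd, hWd⟩, hradd, hcelld, hX4d, hsurjd,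
      htamd⟩ :=
    exists_fieldOne_mult_rankLeOne W p hF5 hF6 hpar hmod hp5 hr hcell hsurj hqp hq2 hqm hqns hqv
  refine ⟨K, iF, iN, Wd, iWd, iWdm, ⟨hK, ⟨q, hqF, ⟨hqp, hq2, hqm, hqns, hqv⟩, hqd, hsplit⟩, h2, hpK⟩,
    ⟨Cd, hWd⟩, hradd, hcelld, hX4d, hsurjd, htamd, fun hr0 htam ↦ ?_⟩
  -- FIELD 2 (analytic rank `0`, `p ∤ ∏ c(E)`)
  have hw : W.rootNumber = 1 := (rootNumber_of_analyticRank_le_one W hpar).1 hr0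
  obtain ⟨V, iV, iVm, C', hmultV, hC'⟩ :=
    AdditivePotMult.PotMult.exists_mult_pStar_twist_model (W := W) (p := p) ⟨hcell.2.1, hcell.2.2⟩ hp2
  obtain ⟨K'', iF'', iN'', A, iA, iAm, hRKF, hfree, hAWd, hrA, hmA, hsurjA, hram, htamA⟩ :=
    exists_fieldTwo_mult W p K hFH hnf hmod hp5 hw hcell.2.1 hsurj htam hqp hq2 hqm hqns hqv hK h2K hqd
      hsplit Cd hWd V C' hC' hmultV
  exact ⟨K'', iF'', iN'', A, iA, iAm, hRKF, hfree, hAWd, hrA, hmA, hsurjA, hram, htamA⟩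

end Summit.BirchSwinnertonDyer.BirchSwinnertonDyer.Theorems.ThreeFieldRoadSupply

end
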